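import Mathlib
import HarnessLib
import Literature.Analysis.Convex.KrasnoselskijIteration
import Literature.Analysis.Convex.ConvexMetricProjection
import Literature.Analysis.Convex.SchauderFixedPoint

/-!
# Browder's approximants `z_t = t u + (1 − t) T z_t` of a nonexpansive map [Bro67], [Rei80]

Analysis/Convex file (everything PROVED; no named facts, no `sorry`).

Let `E` be a real inner product space, `T : E → E` nonexpansive (`‖Tx − Ty‖ ≤ ‖x − y‖`) and `u ∈ E`
an anchor. For `t ∈ (0, 1]` the map `B_t x = t u + (1 − t) T x` is a strict contraction with ratio
`1 − t`, so it has a unique fixed point `z_t` (in a complete space). **Browder's theorem** [Bro67] —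
in the words of [Kör15, Thm 1.1]: "Let `H` be a Hilbert space, `S` a nonexpansive mapping of `H`
into `H`. Suppose that there exists a bounded closed convex subset `C` of `H` mapped by `S` into
itself. Let `u₀` be an arbitrary point of `C`, and for each `t` with `0 < t < 1`, let `S_t x = t S x
+ (1 − t) u₀`. Then `S_t` is a strict contraction of `H` with ratio `t`, `S_t` has a unique fixed
point `z_t` in `C`, and `z_t` converges as `t → 1` strongly in `H` to a fixed point `v` of `S` in
`C`. The fixed point `v` is uniquely specified as the fixed point of `S` closest to `u₀`." — and in
Reich's parametrisation [Kör15, Thm 1.2] / [Rei80]: `z_t := t u + (1 − t) S z_t` converges strongly,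
as `t → 0`, to a fixed point of `S` (Reich: uniformly smooth Banach spaces; here: inner product
spaces, where the limit is the nearest fixed point `P_{Fix T}(u)`). Independently [Hal67] (unit
ball, `u = 0`); see [Ber07, Ch. 3, notes] for the history.

## Contents

* `browderMap T u t = B_t`, `lipschitzWith_browderMap` / `contractingWith_browderMap` (ratio `1 −
  t`), `exists_fixedPoint_browderMap` (Banach, complete space), `eq_of_fixedPoint_browderMap`
  (uniqueness, any space), `IsBrowderPath T u z` (the predicate `z t = t u + (1 − t) T (z t)` on
  `(0, 1]`), `exists_isBrowderPath`.
* A priori estimates for a Browder path and `p ∈ Fix T`, `t ∈ (0, 1]` (the standard ingredients of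
  Browder's proof): `‖z_t − p‖ ≤ ‖u − p‖`; `z_t − T z_t = t (u − T z_t)`, hence `‖z_t − T z_t‖ ≤
  2t‖u − p‖ → 0`; the **key inequality** `‖z_t − p‖² ≤ ⟨u − p, z_t − p⟩` (equivalently `⟨z_t − u,
  z_t − p⟩ ≤ 0`), from the monotonicity of `I − T`; `z_t ∈ C` whenever `u ∈ C`, `T(C) ⊆ C`, `C`
  closed convex (complete space).
* **Main theorem** (`IsBrowderPath.tendsto_proj_fixedPoints`, proper = finite-dimensional real inner
  product space, `Fix T ≠ ∅`): `z_t → P_{Fix T}(u)` as `t → 0⁺` (filter `𝓝[>] 0`), via the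
  sequential form `tendsto_proj_fixedPoints_seq`; Browder's own parametrisation `λ → 1⁻`
  (`tendsto_proj_fixedPoints_of_browder`); and Browder's hypothesis form
  (`fixedPoints_nonempty_of_mapsTo`: a nonexpansive self-map of a nonempty bounded closed convex set
  of a proper space has a fixed point there — from the tree's Schauder theorem — so that
  `tendsto_proj_fixedPoints_of_mapsTo` needs no fixed point a priori).

## Deviations (stated, not hidden)

* Hilbert space → PROPER real inner product space in the convergence theorems: Browder's proof uses
  weak compactness of `(z_t)` and demiclosedness of `I − T`; we use norm-compactness of bounded sets
  and continuity instead (as in the tree's `HalpernIteration`). All a priori estimates and the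
  existence/uniqueness of `z_t` are proved in general (complete, resp. arbitrary) inner product
  spaces.
* The limit is identified as `P_{Fix T}(u)` for the GLOBAL fixed point set (Browder: the fixed point
  in `C` closest to `u₀`; when `u ∈ C` and `T(C) ⊆ C` the two coincide because `z_t ∈ C` and `C` is
  closed, `IsBrowderPath.mem_of_mapsTo`).
* No rates (Browder's theorem is ineffective; [Kör15] extracts rates of metastability, not
  transcribed).

## Mathlib / tree search

Mathlib v4.32.0: `ContractingWith.fixedPoint` (Banach), no Browder/Halpern/Reich approximants (`lean
search 'Browder'`: Browder only in the tree's Brouwer/continuation files; `approximant`: Padé only).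
Tree: `HalpernIteration` (Wittmann's EXPLICIT scheme `x_{n+1} = α_n u + (1 − α_n) T x_n`, a
different object; its three elementary facts `continuous_of_nonexpansive`,
`isClosed_fixedPoints_of_nonexpansive`, `convex_fixedPoints` [GK90, Lemma 3.4] are repeated below as
`private` copies so that this file does not import it), `KrasnoselskijIteration`
(`norm_sq_convex_combination`), `ConvexMetricProjection` (`proj`, `proj_mem`,
`inner_sub_proj_le_zero`), `SchauderFixedPoint` (`exists_fixedPoint_of_isCompact_closure`).

References: [Bro67] Browder 1967 (Arch. Rational Mech. Anal. 24, 82–90); [Rei80] Reich 1980; [Kör15]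
Körnlein 2015 (arXiv:1310.6874), Thms 1.1–1.2; [Hal67] Halpern 1967; [Ber07] Berinde 2007, Ch. 3
notes; [GK90] Goebel–Kirk 1990, Lemma 3.4; [Deu01] Deutsch 2001, Thms 3.4/4.1.
-/

noncomputable section

open Filter Topology Set Function
open scoped RealInnerProductSpace NNReal

namespace Literature.Analysis.Convex.BrowderApproximants

open Literature.Analysis.Convex.ConvexMetricProjection
open Literature.Analysis.Convex.KrasnoselskijIteration


/-! ## Nonexpansive maps: three elementary facts (private local copies)

The public versions live in `Literature.Analysis.Convex.HalpernIteration` (same proofs); they are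
repeated here as `private` lemmas so that this file imports only `KrasnoselskijIteration`,
`ConvexMetricProjection` and `SchauderFixedPoint`. -/

section NonexpansiveLocal
variable {E : Type*} [NormedAddCommGroup E] {T : E → E}

/-- A nonexpansive map is `1`-Lipschitz (plumbing between the hypothesis form used in this file and
Mathlib's `LipschitzWith`). [folklore] -/
private theorem lipschitzWith_one_of_nonexpansive (hT : ∀ x y, ‖T x - T y‖ ≤ ‖x - y‖) :
    LipschitzWith 1 T :=
  LipschitzWith.mk_one fun x y => by rw [dist_eq_norm, dist_eq_norm]; exact hT x y

/-- A nonexpansive map is continuous ("Fix T is closed because T is continuous", [GK90, p. 29]);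
private copy of `HalpernIteration.continuous_of_nonexpansive`.
[cite: GoebelKirk1990, Ch. 3, Lemma 3.4] -/
private theorem continuous_of_nonexpansive (hT : ∀ x y, ‖T x - T y‖ ≤ ‖x - y‖) : Continuous T :=
  (lipschitzWith_one_of_nonexpansive hT).continuous

/-- **[GK90, Lemma 3.4]**, closedness: `Fix T` is closed; private copy of
`HalpernIteration.isClosed_fixedPoints_of_nonexpansive`. [cite: GoebelKirk1990, Ch. 3, Lemma 3.4] -/
private theorem isClosed_fixedPoints_of_nonexpansive (hT : ∀ x y, ‖T x - T y‖ ≤ ‖x - y‖) :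
    IsClosed (Function.fixedPoints T) :=
  isClosed_fixedPoints (continuous_of_nonexpansive hT)

variable [InnerProductSpace ℝ E]

/-- **[GK90, Lemma 3.4]**, convexity: in an inner product space (which is strictly convex) the fixed
point set of a nonexpansive map is convex. Proof via the identity
`‖(1−t)a + tb‖² = (1−t)‖a‖² + t‖b‖² − t(1−t)‖a − b‖²` applied to `a = p − Tx`, `b = q − Tx`;
private copy of `HalpernIteration.convex_fixedPoints`. [cite: GoebelKirk1990, Ch. 3, Lemma 3.4] -/
private theorem convex_fixedPoints (hT : ∀ x y, ‖T x - T y‖ ≤ ‖x - y‖) :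
    Convex ℝ (Function.fixedPoints T) := by
  intro p hp q hq a b ha hb hab
  rw [Function.mem_fixedPoints_iff] at hp hq ⊢
  obtain rfl : a = 1 - b := by linarith
  set x : E := (1 - b) • p + b • q with hx
  have hpx : p - x = b • (p - q) := by rw [hx]; module
  have hqx : q - x = (1 - b) • (q - p) := by rw [hx]; module
  have h1 : ‖p - T x‖ ≤ b * ‖p - q‖ := by
    calc ‖p - T x‖ = ‖T p - T x‖ := by rw [hp]
      _ ≤ ‖p - x‖ := hT p x
      _ = b * ‖p - q‖ := by rw [hpx, norm_smul, Real.norm_of_nonneg hb]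
  have h2 : ‖q - T x‖ ≤ (1 - b) * ‖p - q‖ := by
    calc ‖q - T x‖ = ‖T q - T x‖ := by rw [hq]
      _ ≤ ‖q - x‖ := hT q x
      _ = (1 - b) * ‖p - q‖ := by rw [hqx, norm_smul, Real.norm_of_nonneg ha, norm_sub_rev]
  have hv : x - T x = (1 - b) • (p - T x) + b • (q - T x) := by rw [hx]; module
  have hid : ‖x - T x‖ ^ 2 =
      (1 - b) * ‖p - T x‖ ^ 2 + b * ‖q - T x‖ ^ 2 - b * (1 - b) * ‖(p - T x) - (q - T x)‖ ^ 2 := by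
    rw [hv, norm_sq_convex_combination]
  rw [sub_sub_sub_cancel_right] at hid
  have h1' : ‖p - T x‖ ^ 2 ≤ (b * ‖p - q‖) ^ 2 := pow_le_pow_left₀ (norm_nonneg _) h1 2
  have h2' : ‖q - T x‖ ^ 2 ≤ ((1 - b) * ‖p - q‖) ^ 2 := pow_le_pow_left₀ (norm_nonneg _) h2 2
  have hle : ‖x - T x‖ ^ 2 ≤ 0 := by
    rw [hid]
    nlinarith [mul_le_mul_of_nonneg_left h1' ha, mul_le_mul_of_nonneg_left h2' hb,
      sq_nonneg ‖p - q‖]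
  have h0 : ‖x - T x‖ = 0 := by
    have h00 : ‖x - T x‖ ^ 2 = 0 := le_antisymm hle (sq_nonneg _)
    exact (pow_eq_zero_iff two_ne_zero).1 h00
  rw [norm_eq_zero, sub_eq_zero] at h0
  exact h0.symm


end NonexpansiveLocal

variable {E : Type*} [NormedAddCommGroup E] [InnerProductSpace ℝ E]
variable {T : E → E} {u : E} {t : ℝ}

/-! ## The approximating map `B_t x = t u + (1 − t) T x` and its fixed point `z_t` -/

/-- Browder's approximating map in Reich's parametrisation, `B_t x = t u + (1 − t) T x`
([Kör15, Thm 1.2]: `z_t := t u + (1 − t) S z_t`; Browder's `S_λ x = λ S x + (1 − λ) u₀` is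
`B_{1−λ}`). [cite: Kornlein2015, §1, Thm 1.2] [cite: Browder1967, Thm 1] -/
def browderMap (T : E → E) (u : E) (t : ℝ) (x : E) : E := t • u + (1 - t) • T x

/-- `B_t x = t u + (1 − t) T x`. [cite: Kornlein2015, §1, Thm 1.2] -/
@[simp] theorem browderMap_apply (x : E) : browderMap T u t x = t • u + (1 - t) • T x := rfl

/-- `B_t x − B_t y = (1 − t)(T x − T y)`. [cite: Kornlein2015, §1, Thm 1.1 ("strict contraction with
ratio")] -/
theorem browderMap_sub (x y : E) :
    browderMap T u t x - browderMap T u t y = (1 - t) • (T x - T y) := by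
  simp only [browderMap_apply]
  module

/-- For `T` nonexpansive and `t ≤ 1`, `B_t` is `(1 − t)`-Lipschitz ("`S_t` is a strict
contraction of `H` with ratio `t`" in Browder's parametrisation, [Kör15, Thm 1.1]).
[cite: Kornlein2015, §1, Thm 1.1] [cite: Browder1967, Thm 1] -/
theorem lipschitzWith_browderMap (hT : ∀ x y, ‖T x - T y‖ ≤ ‖x - y‖) (ht1 : t ≤ 1) :
    LipschitzWith (Real.toNNReal (1 - t)) (browderMap T u t) := by
  refine LipschitzWith.of_dist_le_mul fun x y => ?_
  rw [dist_eq_norm, dist_eq_norm, Real.coe_toNNReal _ (by linarith), browderMap_sub, norm_smul,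
    Real.norm_of_nonneg (by linarith)]
  exact mul_le_mul_of_nonneg_left (hT x y) (by linarith)

/-- For `t ∈ (0, 1]`, `B_t` is a strict contraction (ratio `1 − t < 1`).
[cite: Kornlein2015, §1, Thm 1.1] [cite: Browder1967, Thm 1] -/
theorem contractingWith_browderMap (hT : ∀ x y, ‖T x - T y‖ ≤ ‖x - y‖) (ht0 : 0 < t)
    (ht1 : t ≤ 1) : ContractingWith (Real.toNNReal (1 - t)) (browderMap T u t) := by
  refine ⟨?_, lipschitzWith_browderMap hT ht1⟩
  have h : (1 - t : ℝ) < 1 := by linarith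
  exact_mod_cast (Real.toNNReal_lt_toNNReal_iff_of_nonneg (by linarith)).2 h |>.trans_eq
    Real.toNNReal_one

/-- Existence of the approximant: in a complete space `B_t` (`t ∈ (0, 1]`) has a fixed point `z_t`
(Banach's contraction principle; "`S_t` has a unique fixed point `z_t`", [Kör15, Thm 1.1]).
[cite: Kornlein2015, §1, Thm 1.1] [cite: Browder1967, Thm 1] -/
theorem exists_fixedPoint_browderMap [CompleteSpace E] (hT : ∀ x y, ‖T x - T y‖ ≤ ‖x - y‖)
    (ht0 : 0 < t) (ht1 : t ≤ 1) : ∃ z : E, browderMap T u t z = z := by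
  haveI : Nonempty E := ⟨u⟩
  have h := contractingWith_browderMap (u := u) hT ht0 ht1
  exact ⟨ContractingWith.fixedPoint _ h, h.fixedPoint_isFixedPt⟩

/-- Uniqueness of the approximant (any inner product space): two fixed points of `B_t`,
`t ∈ (0, 1]`, coincide, since `‖z − w‖ = (1 − t)‖T z − T w‖ ≤ (1 − t)‖z − w‖`.
[cite: Kornlein2015, §1, Thm 1.1] [cite: Browder1967, Thm 1] -/
theorem eq_of_fixedPoint_browderMap (hT : ∀ x y, ‖T x - T y‖ ≤ ‖x - y‖) (ht0 : 0 < t)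
    (ht1 : t ≤ 1) {z w : E} (hz : browderMap T u t z = z) (hw : browderMap T u t w = w) :
    z = w := by
  have h1 : ‖z - w‖ ≤ (1 - t) * ‖z - w‖ := by
    have e : z - w = (1 - t) • (T z - T w) := by rw [← browderMap_sub (u := u), hz, hw]
    calc ‖z - w‖ = ‖(1 - t) • (T z - T w)‖ := by rw [← e]
      _ = (1 - t) * ‖T z - T w‖ := by rw [norm_smul, Real.norm_of_nonneg (by linarith)]
      _ ≤ (1 - t) * ‖z - w‖ := mul_le_mul_of_nonneg_left (hT z w) (by linarith)
  have h2 : ‖z - w‖ ≤ 0 := by nlinarith [norm_nonneg (z - w)]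
  rw [← sub_eq_zero, ← norm_le_zero_iff]
  exact h2

/-! ## Browder paths `t ↦ z_t` on `(0, 1]` -/

/-- `z : ℝ → E` is a **Browder path** for `(T, u)`: `z t = t u + (1 − t) T (z t)` for every
`t ∈ (0, 1]` (values outside `(0, 1]` are irrelevant). [cite: Kornlein2015, §1, Thm 1.2]
[cite: Browder1967, Thm 1] -/
def IsBrowderPath (T : E → E) (u : E) (z : ℝ → E) : Prop :=
  ∀ ⦃t : ℝ⦄, 0 < t → t ≤ 1 → z t = t • u + (1 - t) • T (z t)

/-- In a complete space a Browder path exists (choose the fixed point of `B_t` for each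
`t ∈ (0, 1]`). [cite: Kornlein2015, §1, Thm 1.1] [cite: Browder1967, Thm 1] -/
theorem exists_isBrowderPath [CompleteSpace E] (hT : ∀ x y, ‖T x - T y‖ ≤ ‖x - y‖) (u : E) :
    ∃ z : ℝ → E, IsBrowderPath T u z := by
  classical
  refine ⟨fun t => if h : 0 < t ∧ t ≤ 1 then
      (exists_fixedPoint_browderMap (u := u) hT h.1 h.2).choose else u, ?_⟩
  intro t ht0 ht1
  have hc : 0 < t ∧ t ≤ 1 := ⟨ht0, ht1⟩
  simp only [dif_pos hc]
  have hspec := (exists_fixedPoint_browderMap (u := u) hT hc.1 hc.2).choose_spec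
  rw [browderMap_apply] at hspec
  exact hspec.symm

namespace IsBrowderPath

variable {z : ℝ → E} {p : E}

/-- A Browder path is unique on `(0, 1]`. [cite: Kornlein2015, §1, Thm 1.1]
[cite: Browder1967, Thm 1] -/
theorem eq_of_isBrowderPath (h : IsBrowderPath T u z) {w : ℝ → E} (hw : IsBrowderPath T u w)
    (hT : ∀ x y, ‖T x - T y‖ ≤ ‖x - y‖) (ht0 : 0 < t) (ht1 : t ≤ 1) : z t = w t :=
  eq_of_fixedPoint_browderMap (u := u) hT ht0 ht1 (by rw [browderMap_apply, ← h ht0 ht1])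
    (by rw [browderMap_apply, ← hw ht0 ht1])

/-- `z_t − p = t(u − p) + (1 − t)(T z_t − p)`. [cite: Browder1967, Thm 1 (proof)]
[cite: Kornlein2015, §1, Thm 1.1] -/
theorem sub_eq (h : IsBrowderPath T u z) (ht0 : 0 < t) (ht1 : t ≤ 1) (p : E) :
    z t - p = t • (u - p) + (1 - t) • (T (z t) - p) := by
  have e := h ht0 ht1
  -- rewrite only the leading `z t`
  calc z t - p = (t • u + (1 - t) • T (z t)) - p := by rw [← e]
    _ = t • (u - p) + (1 - t) • (T (z t) - p) := by module

/-- **Boundedness**: `‖z_t − p‖ ≤ ‖u − p‖` for every fixed point `p` (from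
`‖z_t − p‖ ≤ t‖u − p‖ + (1 − t)‖T z_t − T p‖`). [cite: Browder1967, Thm 1 (proof)]
[cite: Kornlein2015, §1, Thm 1.1] -/
theorem norm_sub_fixedPoint_le (h : IsBrowderPath T u z) (hT : ∀ x y, ‖T x - T y‖ ≤ ‖x - y‖)
    (hp : T p = p) (ht0 : 0 < t) (ht1 : t ≤ 1) : ‖z t - p‖ ≤ ‖u - p‖ := by
  have h1 : ‖z t - p‖ ≤ t * ‖u - p‖ + (1 - t) * ‖z t - p‖ := by
    calc ‖z t - p‖ = ‖t • (u - p) + (1 - t) • (T (z t) - p)‖ := by rw [h.sub_eq ht0 ht1 p]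
      _ ≤ ‖t • (u - p)‖ + ‖(1 - t) • (T (z t) - p)‖ := norm_add_le _ _
      _ = t * ‖u - p‖ + (1 - t) * ‖T (z t) - T p‖ := by
          rw [norm_smul, norm_smul, Real.norm_of_nonneg ht0.le,
            Real.norm_of_nonneg (by linarith), hp]
      _ ≤ t * ‖u - p‖ + (1 - t) * ‖z t - p‖ := by
          have := mul_le_mul_of_nonneg_left (hT (z t) p) (show (0 : ℝ) ≤ 1 - t by linarith)
          linarith
  have h2 : t * ‖z t - p‖ ≤ t * ‖u - p‖ := by linarith
  exact le_of_mul_le_mul_left h2 ht0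

/-- The residual identity `z_t − T z_t = t (u − T z_t)`. [cite: Browder1967, Thm 1 (proof)]
[cite: Kornlein2015, §1, Thm 1.2] -/
theorem sub_apply_eq (h : IsBrowderPath T u z) (ht0 : 0 < t) (ht1 : t ≤ 1) :
    z t - T (z t) = t • (u - T (z t)) := by
  have e := h ht0 ht1
  calc z t - T (z t) = (t • u + (1 - t) • T (z t)) - T (z t) := by rw [← e]
    _ = t • (u - T (z t)) := by module

/-- **Asymptotic regularity with a rate in `t`**: `‖z_t − T z_t‖ ≤ 2t‖u − p‖` for any fixed point
`p` (so `z_t − T z_t → 0` as `t → 0`). [cite: Browder1967, Thm 1 (proof)]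
[cite: Kornlein2015, §1, Thm 1.1] -/
theorem norm_sub_apply_le (h : IsBrowderPath T u z) (hT : ∀ x y, ‖T x - T y‖ ≤ ‖x - y‖)
    (hp : T p = p) (ht0 : 0 < t) (ht1 : t ≤ 1) : ‖z t - T (z t)‖ ≤ 2 * t * ‖u - p‖ := by
  have h1 : ‖u - T (z t)‖ ≤ 2 * ‖u - p‖ := by
    calc ‖u - T (z t)‖ = ‖(u - p) + (T p - T (z t))‖ := by rw [hp]; abel_nf
      _ ≤ ‖u - p‖ + ‖T p - T (z t)‖ := norm_add_le _ _
      _ ≤ ‖u - p‖ + ‖p - z t‖ := by linarith [hT p (z t)]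
      _ ≤ ‖u - p‖ + ‖u - p‖ := by
          rw [norm_sub_rev p]; linarith [h.norm_sub_fixedPoint_le hT hp ht0 ht1]
      _ = 2 * ‖u - p‖ := by ring
  rw [h.sub_apply_eq ht0 ht1, norm_smul, Real.norm_of_nonneg ht0.le]
  nlinarith [norm_nonneg (u - T (z t))]

/-- **The key inequality** of Browder's argument: `‖z_t − p‖² ≤ ⟨u − p, z_t − p⟩` for every fixed
point `p` and `t ∈ (0, 1]`. Proof: `‖z_t − p‖² = t⟨u − p, z_t − p⟩ + (1 − t)⟨T z_t − T p, z_t − p⟩`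
and `⟨T z_t − T p, z_t − p⟩ ≤ ‖z_t − p‖²` by nonexpansiveness (monotonicity of `I − T`).
[cite: Browder1967, Thm 1 (proof)] [cite: Kornlein2015, §1, Thm 1.1] -/
theorem norm_sub_fixedPoint_sq_le_inner (h : IsBrowderPath T u z)
    (hT : ∀ x y, ‖T x - T y‖ ≤ ‖x - y‖) (hp : T p = p) (ht0 : 0 < t) (ht1 : t ≤ 1) :
    ‖z t - p‖ ^ 2 ≤ ⟪u - p, z t - p⟫ := by
  have hsplit : ‖z t - p‖ ^ 2 = t * ⟪u - p, z t - p⟫ + (1 - t) * ⟪T (z t) - p, z t - p⟫ := by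
    rw [← real_inner_self_eq_norm_sq]
    nth_rewrite 1 [h.sub_eq ht0 ht1 p]
    rw [inner_add_left, real_inner_smul_left, real_inner_smul_left]
  have hB : ⟪T (z t) - p, z t - p⟫ ≤ ‖z t - p‖ ^ 2 := by
    calc ⟪T (z t) - p, z t - p⟫ ≤ ‖T (z t) - p‖ * ‖z t - p‖ := real_inner_le_norm _ _
      _ ≤ ‖z t - p‖ * ‖z t - p‖ := by
          refine mul_le_mul_of_nonneg_right ?_ (norm_nonneg _)
          calc ‖T (z t) - p‖ = ‖T (z t) - T p‖ := by rw [hp]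
            _ ≤ ‖z t - p‖ := hT _ _
      _ = ‖z t - p‖ ^ 2 := by ring
  have h1 : t * ‖z t - p‖ ^ 2 ≤ t * ⟪u - p, z t - p⟫ := by
    have h1t : (0 : ℝ) ≤ 1 - t := by linarith
    nlinarith [mul_le_mul_of_nonneg_left hB h1t]
  exact le_of_mul_le_mul_left h1 ht0

/-- Browder's form of the key inequality: `⟨z_t − u, z_t − p⟩ ≤ 0` for every fixed point `p`.
[cite: Browder1967, Thm 1 (proof)] [cite: Kornlein2015, §1, Thm 1.1] -/
theorem inner_sub_anchor_le_zero (h : IsBrowderPath T u z) (hT : ∀ x y, ‖T x - T y‖ ≤ ‖x - y‖)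
    (hp : T p = p) (ht0 : 0 < t) (ht1 : t ≤ 1) : ⟪z t - u, z t - p⟫ ≤ 0 := by
  have e : z t - u = (z t - p) - (u - p) := by abel
  rw [e, inner_sub_left, real_inner_self_eq_norm_sq]
  linarith [h.norm_sub_fixedPoint_sq_le_inner hT hp ht0 ht1]

/-- **`z_t ∈ C`** when `u ∈ C`, `T(C) ⊆ C` and `C` is closed and convex (complete space): `B_t` maps
`C` into itself, so its Picard iterates from `u` stay in `C` and converge to the unique fixed point
("`S_t` has a unique fixed point `z_t` in `C`", [Kör15, Thm 1.1]). [cite: Kornlein2015, §1, Thm 1.1]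
[cite: Browder1967, Thm 1] -/
theorem mem_of_mapsTo [CompleteSpace E] (h : IsBrowderPath T u z)
    (hT : ∀ x y, ‖T x - T y‖ ≤ ‖x - y‖) {C : Set E} (hCconv : Convex ℝ C) (hCcl : IsClosed C)
    (hu : u ∈ C) (hmaps : MapsTo T C C) (ht0 : 0 < t) (ht1 : t ≤ 1) : z t ∈ C := by
  haveI : Nonempty E := ⟨u⟩
  have hc := contractingWith_browderMap (u := u) hT ht0 ht1
  have hB : MapsTo (browderMap T u t) C C := fun x hx => by
    rw [browderMap_apply]
    exact hCconv hu (hmaps hx) ht0.le (by linarith) (by ring)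
  have hiter : ∀ n : ℕ, (browderMap T u t)^[n] u ∈ C := fun n => hB.iterate n hu
  have hlim : Tendsto (fun n : ℕ => (browderMap T u t)^[n] u) atTop
      (𝓝 (ContractingWith.fixedPoint _ hc)) := hc.tendsto_iterate_fixedPoint u
  have hmem : ContractingWith.fixedPoint _ hc ∈ C :=
    hCcl.mem_of_tendsto hlim (Eventually.of_forall hiter)
  have heq : z t = ContractingWith.fixedPoint _ hc :=
    eq_of_fixedPoint_browderMap (u := u) hT ht0 ht1 (by rw [browderMap_apply, ← h ht0 ht1])
      hc.fixedPoint_isFixedPt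
  rw [heq]
  exact hmem

/-! ## Strong convergence `z_t → P_{Fix T}(u)` (proper space) -/

/-- The `limsup` step of Browder's proof in a proper space, in `ε`-form: along any sequence
`t_n → 0` in `(0, 1]`, eventually `⟨u − P_{Fix T}u, z_{t_n} − P_{Fix T}u⟩ ≤ ε` (a cluster point
of the bounded sequence `z_{t_n}` is a fixed point by `‖z_t − T z_t‖ ≤ 2t‖u − p‖` and continuity
of `T`, and then the variational inequality of the projection applies; [Bro67] uses weak
compactness and demiclosedness here). [cite: Browder1967, Thm 1 (proof)]
[cite: Kornlein2015, §1, Thm 1.1 (remark on the proof)] -/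
theorem eventually_inner_le [ProperSpace E] (h : IsBrowderPath T u z)
    (hT : ∀ x y, ‖T x - T y‖ ≤ ‖x - y‖) (hne : (fixedPoints T).Nonempty) {s : ℕ → ℝ}
    (hs0 : ∀ n, 0 < s n) (hs1 : ∀ n, s n ≤ 1) (hs : Tendsto s atTop (𝓝 0)) {ε : ℝ} (hε : 0 < ε) :
    ∀ᶠ n in atTop, ⟪u - proj (fixedPoints T) u, z (s n) - proj (fixedPoints T) u⟫ ≤ ε := by
  have hKc : IsComplete (fixedPoints T) := (isClosed_fixedPoints_of_nonexpansive hT).isComplete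
  have hKv : Convex ℝ (fixedPoints T) := convex_fixedPoints hT
  set q : E := proj (fixedPoints T) u with hq_def
  have hqK : q ∈ fixedPoints T := proj_mem hne hKc hKv u
  have hq : T q = q := mem_fixedPoints_iff.1 hqK
  by_contra hcon
  rw [Filter.not_eventually] at hcon
  obtain ⟨φ, hφ, hφε⟩ := Filter.extraction_of_frequently_atTop hcon
  have hbd : ∀ n, (fun n => z (s (φ n))) n ∈ Metric.closedBall q ‖u - q‖ := fun n => by
    rw [Metric.mem_closedBall, dist_eq_norm]
    exact h.norm_sub_fixedPoint_le hT hq (hs0 _) (hs1 _)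
  obtain ⟨w, -, ψ, hψ, hw⟩ := tendsto_subseq_of_bounded Metric.isBounded_closedBall hbd
  have hw' : Tendsto (fun n => z (s (φ (ψ n)))) atTop (𝓝 w) := hw
  -- the residual tends to zero along the subsequence
  have hres : Tendsto (fun n => ‖z (s (φ (ψ n))) - T (z (s (φ (ψ n))))‖) atTop (𝓝 0) := by
    have hs' : Tendsto (fun n => 2 * s (φ (ψ n)) * ‖u - q‖) atTop (𝓝 0) := by
      have h0 : Tendsto (fun n => s (φ (ψ n))) atTop (𝓝 0) :=
        hs.comp ((hφ.comp hψ).tendsto_atTop)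
      simpa using (h0.const_mul 2).mul_const ‖u - q‖
    exact squeeze_zero (fun n => norm_nonneg _)
      (fun n => h.norm_sub_apply_le hT hq (hs0 _) (hs1 _)) hs'
  have hcont : Tendsto (fun n => ‖z (s (φ (ψ n))) - T (z (s (φ (ψ n))))‖) atTop
      (𝓝 ‖w - T w‖) :=
    (hw'.sub (((continuous_of_nonexpansive hT).tendsto w).comp hw')).norm
  have hTw : T w = w := by
    have h0 : ‖w - T w‖ = 0 := tendsto_nhds_unique hcont hres
    rw [norm_eq_zero, sub_eq_zero] at h0
    exact h0.symm
  have hwK : w ∈ fixedPoints T := mem_fixedPoints_iff.2 hTw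
  have hinner : Tendsto (fun n => ⟪u - q, z (s (φ (ψ n))) - q⟫) atTop (𝓝 ⟪u - q, w - q⟫) :=
    tendsto_const_nhds.inner (hw'.sub_const _)
  have hge : ε ≤ ⟪u - q, w - q⟫ := ge_of_tendsto' hinner fun n => (not_le.1 (hφε (ψ n))).le
  have hle : ⟪u - q, w - q⟫ ≤ 0 := inner_sub_proj_le_zero hne hKc hKv u hwK
  linarith

/-- **Browder's theorem, sequential form** (proper real inner product space): if `T` is
nonexpansive with `Fix T ≠ ∅` and `z` is a Browder path, then `z_{t_n} → P_{Fix T}(u)` for every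
sequence `t_n → 0` in `(0, 1]`. [cite: Browder1967, Thm 1] [cite: Kornlein2015, §1, Thms 1.1–1.2] -/
theorem tendsto_proj_fixedPoints_seq [ProperSpace E] (h : IsBrowderPath T u z)
    (hT : ∀ x y, ‖T x - T y‖ ≤ ‖x - y‖) (hne : (fixedPoints T).Nonempty) {s : ℕ → ℝ}
    (hs0 : ∀ n, 0 < s n) (hs1 : ∀ n, s n ≤ 1) (hs : Tendsto s atTop (𝓝 0)) :
    Tendsto (fun n => z (s n)) atTop (𝓝 (proj (fixedPoints T) u)) := by
  have hKc : IsComplete (fixedPoints T) := (isClosed_fixedPoints_of_nonexpansive hT).isComplete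
  have hKv : Convex ℝ (fixedPoints T) := convex_fixedPoints hT
  set q : E := proj (fixedPoints T) u with hq_def
  have hq : T q = q := mem_fixedPoints_iff.1 (proj_mem hne hKc hKv u)
  rw [tendsto_iff_norm_sub_tendsto_zero]
  refine tendsto_order.2 ⟨fun a ha => Eventually.of_forall fun n => ha.trans_le (norm_nonneg _),
    fun b hb => ?_⟩
  have hb2 : (0 : ℝ) < b ^ 2 / 2 := by positivity
  filter_upwards [h.eventually_inner_le hT hne hs0 hs1 hs hb2] with n hn
  have hsq : ‖z (s n) - q‖ ^ 2 < b ^ 2 := by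
    have := h.norm_sub_fixedPoint_sq_le_inner hT hq (hs0 n) (hs1 n)
    nlinarith
  exact lt_of_pow_lt_pow_left₀ 2 hb.le hsq

/-- **Browder's theorem [Bro67] / Reich's form [Rei80], in a proper real inner product space**: for
`T` nonexpansive with `Fix T ≠ ∅` and a Browder path `z_t = t u + (1 − t) T z_t`,
`z_t → P_{Fix T}(u)` — the fixed point of `T` nearest to `u` — strongly as `t → 0⁺`.
[cite: Browder1967, Thm 1] [cite: Kornlein2015, §1, Thms 1.1–1.2] [cite: Reich1980, Thm (Hilbert
space case)] -/
theorem tendsto_proj_fixedPoints [ProperSpace E] (h : IsBrowderPath T u z)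
    (hT : ∀ x y, ‖T x - T y‖ ≤ ‖x - y‖) (hne : (fixedPoints T).Nonempty) :
    Tendsto z (𝓝[>] 0) (𝓝 (proj (fixedPoints T) u)) := by
  classical
  refine Filter.tendsto_iff_seq_tendsto.2 fun s hs => ?_
  rw [tendsto_nhdsWithin_iff] at hs
  obtain ⟨hs, hpos⟩ := hs
  have hlt1 : ∀ᶠ n in atTop, s n < 1 := hs.eventually (gt_mem_nhds one_pos)
  -- modify `s` outside the eventual range so that it lies in `(0, 1]` everywhere
  let s' : ℕ → ℝ := fun n => if 0 < s n ∧ s n ≤ 1 then s n else 1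
  have heq : ∀ᶠ n in atTop, s' n = s n := by
    filter_upwards [hpos, hlt1] with n hn hn1
    exact if_pos ⟨hn, hn1.le⟩
  have hs'0 : ∀ n, 0 < s' n := fun n => by
    by_cases hc : 0 < s n ∧ s n ≤ 1
    · simp only [s', if_pos hc]; exact hc.1
    · simp only [s', if_neg hc]; exact one_pos
  have hs'1 : ∀ n, s' n ≤ 1 := fun n => by
    by_cases hc : 0 < s n ∧ s n ≤ 1
    · simp only [s', if_pos hc]; exact hc.2
    · simp only [s', if_neg hc]; exact le_rfl
  have hs' : Tendsto s' atTop (𝓝 0) := hs.congr' (heq.mono fun n hn => hn.symm)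
  have hmain := h.tendsto_proj_fixedPoints_seq hT hne hs'0 hs'1 hs'
  refine hmain.congr' ?_
  filter_upwards [heq] with n hn
  simp only [Function.comp_apply, hn]

end IsBrowderPath

/-! ## Browder's own parametrisation `x_λ = λ T x_λ + (1 − λ) u`, `λ → 1⁻` -/

/-- **Browder's theorem in Browder's parametrisation** [Kör15, Thm 1.1]: if
`x_λ = λ T x_λ + (1 − λ) u` for `λ ∈ [0, 1)`, then `x_λ → P_{Fix T}(u)` as `λ → 1⁻` (proper real
inner product space, `Fix T ≠ ∅`). [cite: Browder1967, Thm 1] [cite: Kornlein2015, §1, Thm 1.1] -/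
theorem tendsto_proj_fixedPoints_of_browder [ProperSpace E] {x : ℝ → E}
    (hx : ∀ ⦃l : ℝ⦄, 0 ≤ l → l < 1 → x l = l • T (x l) + (1 - l) • u)
    (hT : ∀ x y, ‖T x - T y‖ ≤ ‖x - y‖) (hne : (fixedPoints T).Nonempty) :
    Tendsto x (𝓝[<] 1) (𝓝 (proj (fixedPoints T) u)) := by
  -- `z t := x (1 − t)` is a Browder path
  have hz : IsBrowderPath T u (fun t => x (1 - t)) := by
    intro t ht0 ht1
    have e := hx (l := 1 - t) (by linarith) (by linarith)
    calc x (1 - t) = (1 - t) • T (x (1 - t)) + (1 - (1 - t)) • u := e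
      _ = t • u + (1 - t) • T (x (1 - t)) := by rw [sub_sub_cancel, add_comm]
  have hmain := hz.tendsto_proj_fixedPoints hT hne
  have hmap : Tendsto (fun l : ℝ => 1 - l) (𝓝[<] (1 : ℝ)) (𝓝[>] 0) := by
    refine tendsto_nhdsWithin_iff.2 ⟨?_, ?_⟩
    · have hc : Tendsto (fun l : ℝ => 1 - l) (𝓝 (1 : ℝ)) (𝓝 (1 - 1)) :=
        tendsto_const_nhds.sub tendsto_id
      rw [sub_self] at hc
      exact hc.mono_left nhdsWithin_le_nhds
    · exact eventually_nhdsWithin_of_forall fun l hl => by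
        simp only [mem_Iio] at hl; simp only [mem_Ioi]; linarith
  have hcomp := hmain.comp hmap
  refine hcomp.congr fun l => ?_
  simp only [Function.comp_apply, sub_sub_cancel]

/-! ## Browder's hypothesis: a bounded closed convex invariant set (proper space) -/

/-- In a proper space, a nonexpansive map sending a nonempty bounded closed convex set `C` into
itself has a fixed point in `C` (Browder–Göhde–Kirk in Hilbert space; here from the tree's
Schauder fixed point theorem, `C` being compact). [cite: Kornlein2015, §1, Thm 1.1 (hypothesis: "a
bounded closed convex subset `C` of `H` mapped by `S` into itself")] [cite: Browder1967, Thm 1] -/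
theorem fixedPoints_nonempty_of_mapsTo [ProperSpace E] (hT : ∀ x y, ‖T x - T y‖ ≤ ‖x - y‖)
    {C : Set E} (hCconv : Convex ℝ C) (hCcl : IsClosed C) (hCbd : Bornology.IsBounded C)
    (hCne : C.Nonempty) (hmaps : MapsTo T C C) : ∃ p ∈ C, T p = p := by
  have hCcpt : IsCompact C := Metric.isCompact_of_isClosed_isBounded hCcl hCbd
  have hcomp : IsCompact (closure (T '' C)) :=
    hCcpt.of_isClosed_subset isClosed_closure
      (closure_minimal (mapsTo_iff_image_subset.1 hmaps) hCcl)
  exact Literature.Analysis.Convex.exists_fixedPoint_of_isCompact_closure hCconv hCcl hCne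
    (continuous_of_nonexpansive hT).continuousOn hmaps hcomp

/-- **Browder's theorem with Browder's hypotheses** (proper real inner product space): `T`
nonexpansive, `C` nonempty bounded closed convex with `T(C) ⊆ C`, `u ∈ C`, `z` a Browder path. Then
`z_t ∈ C` for `t ∈ (0, 1]` and `z_t → P_{Fix T}(u) ∈ C` as `t → 0⁺`.
[cite: Browder1967, Thm 1] [cite: Kornlein2015, §1, Thm 1.1] -/
theorem tendsto_proj_fixedPoints_of_mapsTo [ProperSpace E] {z : ℝ → E} (h : IsBrowderPath T u z)
    (hT : ∀ x y, ‖T x - T y‖ ≤ ‖x - y‖) {C : Set E} (hCconv : Convex ℝ C) (hCcl : IsClosed C)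
    (hCbd : Bornology.IsBounded C) (hu : u ∈ C) (hmaps : MapsTo T C C) :
    (∀ ⦃t : ℝ⦄, 0 < t → t ≤ 1 → z t ∈ C) ∧
      Tendsto z (𝓝[>] 0) (𝓝 (proj (fixedPoints T) u)) ∧ proj (fixedPoints T) u ∈ C := by
  have hne : (fixedPoints T).Nonempty := by
    obtain ⟨p, -, hp⟩ := fixedPoints_nonempty_of_mapsTo hT hCconv hCcl hCbd ⟨u, hu⟩ hmaps
    exact ⟨p, mem_fixedPoints_iff.2 hp⟩
  have hmem : ∀ ⦃t : ℝ⦄, 0 < t → t ≤ 1 → z t ∈ C := fun t ht0 ht1 =>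
    h.mem_of_mapsTo hT hCconv hCcl hu hmaps ht0 ht1
  have hlim := h.tendsto_proj_fixedPoints hT hne
  refine ⟨hmem, hlim, ?_⟩
  -- the limit of points of `C` along `𝓝[>] 0` (a nontrivial filter) lies in the closed set `C`
  refine hCcl.mem_of_tendsto hlim ?_
  have hIoc : Ioc (0 : ℝ) 1 ∈ 𝓝[>] (0 : ℝ) := Ioc_mem_nhdsGT one_pos
  filter_upwards [hIoc] with t ht
  exact hmem ht.1 ht.2

end Literature.Analysis.Convex.BrowderApproximants

end
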